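import Mathlib.MeasureTheory.Covering.BesicovitchVectorSpace
import HarnessLib

/-!
# Route `CylinderEntropy`, item `ImmortalAreaToFloor` (stmt-SmoothPoincare4-17197): GOOD POINTS (module Γ1)

Besicovitch weak-type bound used to select "good points" of an almost-stationary cross-section
(blueprint `BLUEPRINT-17197-c2.md`, module Γ1): for two measures `μ`, `β` on a space with the
Besicovitch covering property (e.g. `ℝ⁶`), the set of points `x` at which SOME ball
`closedBall x r`, `0 < r ≤ R`, has `β`-mass exceeding `ξ` times its `μ`-mass has `μ`-measure at
most `N β(univ) / ξ`, `N` the Besicovitch constant of the space.  Applied with `μ` the area measure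
of a slice and `β = |H| dμ` (resp. `|ν'|² dμ`) it shows that all but `N (‖H‖₁ + tilt) / ξ` of the
area consists of points at which the mean curvature (resp. the tilt) is RELATIVELY small on every
ball up to radius `R` — the points at which the monotonicity formula applies cleanly
(Allard 1972, §6; Simon 1983, proof of Thm. 42.7).

References: W. K. Allard, *On the first variation of a varifold*, Ann. of Math. 95 (1972), §6;
H. Federer, *Geometric Measure Theory*, 2.8.14 (Besicovitch covering).
-/

noncomputable section

-- the prescribed namespace `Summit.SmoothPoincare4.SmoothPoincare4.…` repeats `SmoothPoincare4`
set_option linter.dupNamespace false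

open MeasureTheory Metric Set Filter
open scoped ENNReal NNReal Topology

namespace Summit.SmoothPoincare4.SmoothPoincare4.Theorems.GoodPoints

variable {α : Type*} [MetricSpace α] [SecondCountableTopology α] [MeasurableSpace α]
  [OpensMeasurableSpace α]

/-- **Besicovitch weak-type bound for the bad set (fixed covering constant).**  If there is no
satellite configuration with `N + 1` points (parameter `τ > 1`), then for any two measures `μ, β`,
any `ξ ≠ 0, ⊤` and any radius bound `R`, the set of points `x` admitting a radius `0 < r ≤ R` with
`ξ μ(B̄(x,r)) < β(B̄(x,r))` has `μ`-measure `≤ N β(univ) / ξ`.  Proof: the topological Besicovitch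
theorem gives `N` disjoint subfamilies of the bad balls covering the bad set; on each bad ball
`μ ≤ β / ξ`, and disjointness sums `β` to at most `β(univ)` per family. [cite: Allard1972, §6] -/
theorem measure_badSet_le_of_isEmpty_satelliteConfig {N : ℕ} {τ : ℝ} (hτ : 1 < τ)
    (hN : IsEmpty (Besicovitch.SatelliteConfig α N τ)) (μ β : Measure α) {ξ : ℝ≥0∞}
    (hξ : ξ ≠ 0) (hξ' : ξ ≠ ⊤) (R : ℝ) :
    μ {x | ∃ r : ℝ, 0 < r ∧ r ≤ R ∧ ξ * μ (closedBall x r) < β (closedBall x r)} ≤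
      N * β univ / ξ := by
  classical
  set S : Set α := {x | ∃ r : ℝ, 0 < r ∧ r ≤ R ∧ ξ * μ (closedBall x r) < β (closedBall x r)}
    with hS
  -- choose a bad radius at every bad point
  have hrad : ∀ x : S, ∃ r : ℝ, 0 < r ∧ r ≤ R ∧
      ξ * μ (closedBall (x : α) r) < β (closedBall (x : α) r) := fun x => x.2
  choose r hr using hrad
  -- the trivial case of an empty bad set
  rcases isEmpty_or_nonempty S with hSe | hSne
  · have : S = ∅ := by
      ext x
      simp only [mem_empty_iff_false, iff_false]
      intro hx
      exact hSe.false ⟨x, hx⟩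
    rw [this, measure_empty]
    exact bot_le
  -- the ball package of bad balls and its Besicovitch subfamilies
  let a : Besicovitch.BallPackage S α :=
    { c := fun x => (x : α)
      r := r
      rpos := fun x => (hr x).1
      r_bound := R
      r_le := fun x => (hr x).2.1 }
  obtain ⟨u, hu, hu'⟩ := Besicovitch.exist_disjoint_covering_families hτ hN a
  have u_count : ∀ i, (u i).Countable := by
    intro i
    refine (hu i).countable_of_nonempty_interior fun j _ => ?_
    have : (ball (j : α) (r j)).Nonempty := nonempty_ball.2 (hr j).1
    exact this.mono ball_subset_interior_closedBall
  -- each bad ball has `μ ≤ β / ξ`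
  have hball : ∀ x : S, μ (closedBall (x : α) (r x)) ≤ β (closedBall (x : α) (r x)) / ξ := by
    intro x
    rw [ENNReal.le_div_iff_mul_le (Or.inl hξ) (Or.inl hξ'), mul_comm]
    exact (hr x).2.2.le
  -- the bad set is covered by the `N` families
  have hcover : S ⊆ ⋃ i : Fin N, ⋃ j ∈ u i, closedBall ((j : S) : α) (r j) := by
    intro x hx
    have hx' : x ∈ range a.c := ⟨⟨x, hx⟩, rfl⟩
    have := hu' hx'
    simp only [mem_iUnion, exists_prop] at this ⊢
    obtain ⟨i, j, hj, hjx⟩ := this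
    exact ⟨i, j, hj, ball_subset_closedBall hjx⟩
  calc μ S ≤ μ (⋃ i : Fin N, ⋃ j ∈ u i, closedBall ((j : S) : α) (r j)) := measure_mono hcover
    _ ≤ ∑ i : Fin N, μ (⋃ j ∈ u i, closedBall ((j : S) : α) (r j)) := measure_iUnion_fintype_le _ _
    _ ≤ ∑ i : Fin N, ∑' j : u i, μ (closedBall ((j : S) : α) (r j)) := by
        gcongr with i
        rw [biUnion_eq_iUnion]
        haveI := (u_count i).to_subtype
        exact measure_iUnion_le _
    _ ≤ ∑ i : Fin N, ∑' j : u i, β (closedBall ((j : S) : α) (r j)) / ξ := by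
        gcongr with i j
        exact hball j
    _ = ∑ i : Fin N, (∑' j : u i, β (closedBall ((j : S) : α) (r j))) / ξ := by
        simp only [div_eq_mul_inv, ENNReal.tsum_mul_right]
    _ = ∑ i : Fin N, β (⋃ j ∈ u i, closedBall ((j : S) : α) (r j)) / ξ := by
        congr 1 with i
        rw [measure_biUnion (u_count i) ?_ fun b _ => measurableSet_closedBall]
        exact hu i
    _ ≤ ∑ _i : Fin N, β univ / ξ := by
        gcongr
        exact subset_univ _
    _ = N * β univ / ξ := by
        simp only [Finset.sum_const, Finset.card_univ, Fintype.card_fin, nsmul_eq_mul]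
        rw [mul_div_assoc]

/-- **Besicovitch weak-type bound for the bad set.**  On a space with the Besicovitch covering
property there is a constant `N` (depending only on the space) such that for any two measures
`μ, β`, any `ξ ≠ 0, ⊤` and any `R`, the set of `x` admitting `0 < r ≤ R` with
`ξ μ(B̄(x,r)) < β(B̄(x,r))` has `μ`-measure `≤ N β(univ) / ξ`.  In particular the GOOD set
`{x | ∀ r ∈ (0, R], β(B̄(x,r)) ≤ ξ μ(B̄(x,r))}` carries all of `μ` but `N β(univ)/ξ`.
[cite: Allard1972, §6] -/
theorem exists_forall_measure_badSet_le (α : Type*) [MetricSpace α] [SecondCountableTopology α]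
    [MeasurableSpace α] [OpensMeasurableSpace α] [HasBesicovitchCovering α] :
    ∃ N : ℕ, ∀ (μ β : Measure α) (ξ : ℝ≥0∞), ξ ≠ 0 → ξ ≠ ⊤ → ∀ R : ℝ,
      μ {x | ∃ r : ℝ, 0 < r ∧ r ≤ R ∧ ξ * μ (closedBall x r) < β (closedBall x r)} ≤
        N * β univ / ξ := by
  obtain ⟨N, τ, hτ, hN⟩ := HasBesicovitchCovering.no_satelliteConfig (α := α)
  exact ⟨N, fun μ β ξ hξ hξ' R => measure_badSet_le_of_isEmpty_satelliteConfig hτ hN μ β hξ hξ' R⟩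

/-- **Two bad sets at once** (mean curvature AND tilt, as used for good points): with the
Besicovitch constant `N` of `exists_forall_measure_badSet_le`, the set of points bad for `β₁` or
for `β₂` has `μ`-measure `≤ N (β₁(univ) + β₂(univ)) / ξ`. [cite: Allard1972, §6] -/
theorem exists_forall_measure_badSet_union_le (α : Type*) [MetricSpace α]
    [SecondCountableTopology α] [MeasurableSpace α] [OpensMeasurableSpace α]
    [HasBesicovitchCovering α] :
    ∃ N : ℕ, ∀ (μ β₁ β₂ : Measure α) (ξ : ℝ≥0∞), ξ ≠ 0 → ξ ≠ ⊤ → ∀ R : ℝ,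
      μ ({x | ∃ r : ℝ, 0 < r ∧ r ≤ R ∧ ξ * μ (closedBall x r) < β₁ (closedBall x r)} ∪
          {x | ∃ r : ℝ, 0 < r ∧ r ≤ R ∧ ξ * μ (closedBall x r) < β₂ (closedBall x r)}) ≤
        N * (β₁ univ + β₂ univ) / ξ := by
  obtain ⟨N, hNb⟩ := exists_forall_measure_badSet_le α
  refine ⟨N, fun μ β₁ β₂ ξ hξ hξ' R => ?_⟩
  calc _ ≤ _ + _ := measure_union_le _ _
    _ ≤ N * β₁ univ / ξ + N * β₂ univ / ξ := add_le_add (hNb μ β₁ ξ hξ hξ' R) (hNb μ β₂ ξ hξ hξ' R)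
    _ = N * (β₁ univ + β₂ univ) / ξ := by
        rw [mul_add, ENNReal.add_div]

end Summit.SmoothPoincare4.SmoothPoincare4.Theorems.GoodPoints

end
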